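import Summits.QuantumFields.BalabanUV.T4Continuum.Support.ShellMeasureExpChartSUN
import Summits.QuantumFields.BalabanUV.T4Continuum.Support.ShellMeasureScalingLocal
import Literature.MathematicalPhysics.QuantumFieldTheory.Balaban1983to89.T4ShellMeasureDet
import Literature.MathematicalPhysics.QuantumFieldTheory.GaussianToolkit

/-!
# `T4Continuum.ShellMeasureScalingSUN` — the scaling engine over the REALIZED configuration space for `G = SU(N)`,
# general `N`: the chart identity (CH) REDUCED to ONE bond at the identity and DISPLAYED, and the realized headline
# with the chart-side weight riding free
# (cell `pub-balaban`, sub-cell `t4`, spine estimate NE7c (node U5b); ROUND-2 crew `t4-ne7c-formalise-*`, row S3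
# «SM-L9 SU(N) chart» of the claim table `t4/b2b-balaban-t4-ne7c-p1/LEAVES-NE7c-P1.md` (trigger
# `t4/T4-NE7c-TRIGGER.json`, condition c5: optional and last — `SU(2)` is the row's certified instance); seat
# `b2b-balaban-t4-ne7c-formalise-leaf-04`; file 2 of 2; tree target `Summits/QuantumFields/BalabanUV/T4Continuum/Support/`;
# ADDITIVE — imports `ShellMeasureExpChartSUN` (file 1: the chart), `ShellMeasureScalingLocal` (the engine),
# `T4ShellMeasureDet` (block law, realized transports) and `GaussianToolkit` (Tonelli for finite products) and modifies
# nothing; generalises `ShellMeasureScalingSU2` §2 from `SU(2)` to `SU(N)` EXCEPT for the one-bond chart identity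
# itself, which for `N ≥ 3` is NOT in the tree and enters as ONE displayed binder `hCH`)

HONEST FRAMING.  Finite four-torus programme, rung (B)+1 only — NOT infinite volume, NOT a mass gap, NOT the Clay
problem, NOT summit progress; (B), `BetaPertHyp`, (B^μ) are not mentioned because nothing here consumes them.  The
cell wall of NE7c — (M1) `T4ShellMeasure.SlotAntiConcentration` FOR BAŁABAN'S INDUCTIVELY DEFINED EFFECTIVE MEASURES —
is NOT PRINTED in [Balaban 1983–89] (GAPS G-ne7cp1-1), asserted by nobody, and NOT moved by this file; a landed S3
changes NOTHING in the countdown (spine PROVED 0/9); every result below reads «(M1) for the realized `SU(N)` law ⇐ the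
named binders», never «NE7c proved».  Every declaration is [folklore] kernel mathematics, 0 sorry, 0 citations
(nothing printed is transcribed; no `def … : Prop` is minted).

THE POINTS.
* §3 (CH) FOR `SU(N)`: REDUCTION TO ONE BOND AT THE IDENTITY.  The block chart identity consumed by
  `T4ShellMeasureDet.slotAntiConcentration_of_chart` — «product Haar on the block, windowed by the image windows
  `u₀ b · exp(B̄_S)` (`windowSU`), IS the image of `volume ⊗ 1_{‖x‖ ≤ S} ∏_b J₁ (x b)` (`chartWeightSU`) under
  `expFibreChartSU Λ u₀`» (`chart_suN`) — FOLLOWS, for every block `Λ` and every centre `u₀`, from the ONE-BOND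
  identity AT THE IDENTITY (CH)₁: `Haar_{SU(N)}|_{exp(B̄_S)} = expPtSU_* (volume|_{B̄_S} · J₁)` (binder `hCH`), by
  left-invariance of the normalised Haar measure `HaarData.haar` (`haar_restrict_expWindowSU`), Tonelli for finite
  products (`GaussianToolkit.pi_withDensity`) and Mathlib's `measurePreserving_pi`.  (CH)₁ is the classical formula for
  Haar measure in exponential coordinates (`J₁ = c_N ∏_{α>0} sinc²(α/2)` on `‖X‖ < π`); for `N = 2` it is the
  tree's `T4HaarSU2ExpChart` / `T4CubeChartExp.cubeChart_specialUnitaryTwo_exp` (in cube coordinates); for `N ≥ 3`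
  it is NOT in the tree and is DISPLAYED, not asserted.  Under (CH)₁ the one-bond chart law is finite
  (`isFiniteMeasure_of_hCH`) and total mass transports (`chartLaw_univ_eq`, the engine's finiteness proviso).
* §4 THE REALIZED ENGINE FOR `G = SU(N)` (`slotAntiConcentration_realized_suN_of_coreMap`): per frozen exterior `V`
  the analytic hypotheses are the core map (S-i) and the ray-weight loss (S-ii) of the block weight `R V` read in the
  chart — on the ball, on the support, below the threshold only — plus the window factorisation `hFw` of the realized
  density, a per-section finiteness, the centre-monotonicity of `J₁` (`hJ₁c`, so that `J₁` and the window ride free by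
  `ShellMeasureExpChartSUN.chartWeightSU_le_smul`) and (CH)₁; the conclusion is (M1) for
  `(fieldMeasure P j SU(N)).withDensity F` with any `D`, `(#Λ·d_N + B_f)·a ≤ D·ρ`.

WHAT THIS DOES NOT DO.  (CH)₁ for `N ≥ 3` is NOT proved (binder `hCH`); the root-space Jacobian is not constructed
here (so `J₁` and its centre-monotonicity are binders); no instance of (S-i)/(S-ii) for Bałaban's localized
minimisers / block weights is constructed; the window factorisation, the chart centres and the per-section finiteness
are hypotheses; (Det), (FI-sat), (LR), (MR), (W1), the (F∞)-rate keep their status.  NE7c NOT proved.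
-/

noncomputable section

namespace Summit.QuantumFields.BalabanUV.T4Continuum.ShellMeasureScalingSUN

open MeasureTheory Set Function Metric
open scoped ENNReal
open Literature.MathematicalPhysics.QuantumFieldTheory.Balaban1983to89
open T4ShellMeasure (SlotAntiConcentration)
open ShellMeasureScalingLocal (slotAntiConcentration_of_coreMap_mul)
open ShellMeasureExpChartSUN

variable {N : ℕ}

/-! ## §2b Cost-free block chart weights from one-bond weights monotone along POSITIVE contractions only -/

section Window

variable {P : Params} {j : ℕ} (Λ : Finset (PBond P j))

/-- `ShellMeasureExpChartSUN.chartWeightSU_le_smul` with the one-bond monotonicity asked for POSITIVE contraction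
factors only (`J₁ v ≤ J₁ (c • v)` for `‖v‖ ≤ S`, `0 < c ≤ 1`) — the form met by weights defined off a null cone
(value `0` there), such as a determinant formula for the exponential Haar Jacobian; the engine only contracts by
`e^{−a} > 0`. [folklore] -/
theorem chartWeightSU_le_smul_of_pos {S : ℝ} {J₁ : ChartSU N → ℝ≥0∞}
    (hJ₁ : ∀ v : ChartSU N, ‖v‖ ≤ S → ∀ c : ℝ, 0 < c → c ≤ 1 → J₁ v ≤ J₁ (c • v)) {a : ℝ} (ha : 0 ≤ a)
    (x : BlockChartSU N Λ) :
    chartWeightSU Λ S J₁ x ≤ chartWeightSU Λ S J₁ (Real.exp (-a) • x) := by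
  have hc0 : 0 < Real.exp (-a) := Real.exp_pos _
  have hc1 : Real.exp (-a) ≤ 1 := by rw [Real.exp_le_one_iff]; linarith
  unfold chartWeightSU
  by_cases hx : x ∈ closedBall (0 : BlockChartSU N Λ) S
  · rw [indicator_of_mem hx, indicator_of_mem (smul_mem_closedBall_zero hx hc0.le hc1)]
    refine Finset.prod_le_prod' fun b _ => ?_
    rw [Pi.smul_apply]
    exact hJ₁ (x b) (norm_apply_le_of_mem_closedBall Λ hx b) _ hc0 hc1
  · rw [indicator_of_notMem hx]
    exact bot_le

end Window

/-! ## §3 (CH) for `SU(N)`: from ONE bond at the identity to every block and every centre -/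

section ChartIdentity


/-- THE IMAGE BALL `exp(B̄_S) ⊆ SU(N)`: the chart points with coordinates of norm `≤ S`. [folklore] -/
def expBallSU (S : ℝ) : Set (SUN N) := expPtSU '' closedBall (0 : ChartSU N) S

/-- THE IMAGE WINDOW about `g`: `g · exp(B̄_S)`. [folklore] -/
def expWindowSU (g : SUN N) (S : ℝ) : Set (SUN N) := (fun h => g * h) '' expBallSU S

/-- the image window about `g` is the image of the ball under the chart about `g`. [folklore] -/
theorem expWindowSU_eq_image (g : SUN N) (S : ℝ) : expWindowSU g S = expChartSU g '' closedBall (0 : ChartSU N) S := by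
  rw [expWindowSU, expBallSU, expChartSU_eq_comp, Set.image_comp]

/-- the image ball is compact (continuous image of a compact ball), hence measurable. [folklore] -/
theorem measurableSet_expBallSU (S : ℝ) : MeasurableSet (expBallSU (N := N) S) :=
  ((isCompact_closedBall (0 : ChartSU N) S).image continuous_expPtSU).isClosed.measurableSet

/-- the image window is measurable. [folklore] -/
theorem measurableSet_expWindowSU (g : SUN N) (S : ℝ) : MeasurableSet (expWindowSU g S) := by
  rw [expWindowSU_eq_image]
  exact ((isCompact_closedBall (0 : ChartSU N) S).image (continuous_expChartSU g)).isClosed.measurableSet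

/-- left translation pulls the window about `g` back to the image ball. [folklore] -/
theorem preimage_mul_expWindowSU (g : SUN N) (S : ℝ) : (fun h => g * h) ⁻¹' expWindowSU g S = expBallSU S :=
  (mul_right_injective g).preimage_image _

/-- left translation by `g` is measurable on `SU(N)`. [folklore] -/
theorem measurable_mul_left (g : SUN N) : Measurable fun h : SUN N => g * h :=
  (continuous_const.mul continuous_id).measurable

variable {P : Params} {j : ℕ}

open T4ShellMeasureDet (blockLaw blockLaw_eq_pi)

/-- THE BLOCK-SIDE WINDOW WEIGHT about `u₀`: the indicator of «every bond of the block in its image window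
`u₀ b · exp(B̄_S)`», as a product of one-bond indicators. [folklore] -/
def windowSU (Λ : Finset (PBond P j)) (u₀ : GaugeField P j (SUN N)) (S : ℝ) (y : ↥Λ → SUN N) : ℝ≥0∞ :=
  ∏ b : ↥Λ, (expWindowSU (u₀ b) S).indicator (1 : SUN N → ℝ≥0∞) (y b)

variable (Λ : Finset (PBond P j)) (u₀ : GaugeField P j (SUN N))

/-- the block-side window weight is the indicator of the product window. [folklore] -/
theorem windowSU_eq_indicator (S : ℝ) :
    windowSU Λ u₀ S =
      (Set.pi univ fun b : ↥Λ => expWindowSU (u₀ b) S).indicator (1 : (↥Λ → SUN N) → ℝ≥0∞) := by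
  funext y
  unfold windowSU
  by_cases hy : y ∈ Set.pi univ fun b : ↥Λ => expWindowSU (u₀ b) S
  · rw [indicator_of_mem hy, Pi.one_apply]
    exact Finset.prod_eq_one fun b _ => by rw [indicator_of_mem (hy b (mem_univ b)), Pi.one_apply]
  · rw [indicator_of_notMem hy]
    obtain ⟨b, hb⟩ : ∃ b : ↥Λ, y b ∉ expWindowSU (u₀ b) S := by
      by_contra h
      exact hy fun b _ => (not_exists_not.mp h) b
    exact Finset.prod_eq_zero (Finset.mem_univ b) (indicator_of_notMem hb _)

/-- the block-side window weight is measurable. [folklore] -/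
theorem measurable_windowSU (S : ℝ) : Measurable (windowSU Λ u₀ S) := by
  rw [windowSU_eq_indicator]
  exact measurable_one.indicator (MeasurableSet.univ_pi fun b : ↥Λ => measurableSet_expWindowSU (u₀ b) S)

/-- the block-side window weight takes the values `0` and `1` only; in particular it is `≤ 1`. [folklore] -/
theorem windowSU_le_one (S : ℝ) (y : ↥Λ → SUN N) : windowSU Λ u₀ S y ≤ 1 := by
  rw [windowSU_eq_indicator]
  by_cases hy : y ∈ Set.pi univ fun b : ↥Λ => expWindowSU (u₀ b) S
  · rw [indicator_of_mem hy, Pi.one_apply]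
  · rw [indicator_of_notMem hy]
    exact zero_le_one

variable [NeZero N]

/-- **HAAR ON THE WINDOW ABOUT `g` IS THE TRANSLATE OF HAAR ON THE IMAGE BALL** (left-invariance of the normalised Haar
measure `HaarData.haar`). [folklore] -/
theorem haar_restrict_expWindowSU (g : SUN N) (S : ℝ) :
    (HaarData.haar : Measure (SUN N)).restrict (expWindowSU g S) =
      ((HaarData.haar : Measure (SUN N)).restrict (expBallSU S)).map fun h => g * h := by
  conv_lhs => rw [← HaarData.map_mul_left (G := SUN N) g]
  rw [Measure.restrict_map (measurable_mul_left g) (measurableSet_expWindowSU g S), preimage_mul_expWindowSU]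

/-- the windowed block law is product Haar restricted bondwise to the image windows. [folklore] -/
theorem blockLaw_withDensity_windowSU (S : ℝ) :
    (blockLaw Λ).withDensity (windowSU Λ u₀ S) =
      Measure.pi fun b : ↥Λ => (HaarData.haar : Measure (SUN N)).restrict (expWindowSU (u₀ b) S) := by
  rw [windowSU_eq_indicator,
    withDensity_indicator_one (MeasurableSet.univ_pi fun b : ↥Λ => measurableSet_expWindowSU (u₀ b) S),
    blockLaw_eq_pi, Measure.restrict_pi_pi]

/-- under (CH)₁ the one-bond chart law `volume|_{B̄_S} · J₁` is a finite measure (its image is a piece of a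
probability measure). [folklore] -/
theorem isFiniteMeasure_of_hCH {S : ℝ} {J₁ : ChartSU N → ℝ≥0∞}
    (hCH : (HaarData.haar : Measure (SUN N)).restrict (expBallSU S) =
      (((volume : Measure (ChartSU N)).restrict (closedBall 0 S)).withDensity J₁).map expPtSU) :
    IsFiniteMeasure (((volume : Measure (ChartSU N)).restrict (closedBall 0 S)).withDensity J₁) := by
  haveI := HaarData.isProb (G := SUN N)
  refine ⟨?_⟩
  rw [← preimage_univ (f := expPtSU (N := N)), ← Measure.map_apply measurable_expPtSU MeasurableSet.univ, ← hCH]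
  exact measure_lt_top _ _

/-- **(CH) FOR `SU(N)` — THE BLOCK CHART IDENTITY FROM ONE BOND AT THE IDENTITY.**  HYPOTHESIS (CH)₁ (`hCH`,
DISPLAYED, not asserted): on the image ball `exp(B̄_S)` the normalised Haar measure of `SU(N)` is the image of
`volume|_{B̄_S} · J₁` under the one-bond chart `expPtSU`, for a measurable one-bond weight `J₁` (classically
`J₁ = c_N ∏_{α>0} sinc²(α/2)`, `S < π`; in the tree for `N = 2` only).  CONCLUSION: for every block `Λ` and every
centre `u₀`, product Haar on the block windowed by `windowSU Λ u₀ S` IS the image of `volume` tilted by the block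
chart weight `1_{‖x‖ ≤ S} · ∏_b J₁ (x b)` under the block chart `expFibreChartSU Λ u₀` — the orientation and shape of
`T4ShellMeasureDet.slotAntiConcentration_of_chart`.  Left-invariance of Haar bond by bond, Tonelli for finite
products, `measurePreserving_pi`. [folklore] -/
theorem chart_suN {S : ℝ} (hS : 0 ≤ S) {J₁ : ChartSU N → ℝ≥0∞} (hJ₁ : Measurable J₁)
    (hCH : (HaarData.haar : Measure (SUN N)).restrict (expBallSU S) =
      (((volume : Measure (ChartSU N)).restrict (closedBall 0 S)).withDensity J₁).map expPtSU) :
    (blockLaw Λ).withDensity (windowSU Λ u₀ S) =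
      ((volume : Measure (BlockChartSU N Λ)).withDensity (chartWeightSU Λ S J₁)).map (expFibreChartSU Λ u₀) := by
  haveI := HaarData.isProb (G := SUN N)
  haveI := isFiniteMeasure_of_hCH hCH
  -- one bond about `g`: the chart about `g` pushes `volume|_{B̄_S} · J₁` to Haar on the window about `g`
  have hone : ∀ g : SUN N, MeasurePreserving (expChartSU g)
      (((volume : Measure (ChartSU N)).restrict (closedBall 0 S)).withDensity J₁)
      ((HaarData.haar : Measure (SUN N)).restrict (expWindowSU g S)) := fun g => by
    refine ⟨measurable_expChartSU g, ?_⟩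
    rw [haar_restrict_expWindowSU, hCH, Measure.map_map (measurable_mul_left g) measurable_expPtSU]
    rfl
  -- the block: `measurePreserving_pi`
  have hpi := measurePreserving_pi
    (fun _ : ↥Λ => ((volume : Measure (ChartSU N)).restrict (closedBall 0 S)).withDensity J₁)
    (fun b : ↥Λ => (HaarData.haar : Measure (SUN N)).restrict (expWindowSU (u₀ b) S)) fun b => hone (u₀ b)
  rw [blockLaw_withDensity_windowSU, ← hpi.map_eq]
  -- the chart-side product law is `volume` tilted by the block chart weight
  congr 1
  rw [Literature.MathematicalPhysics.QuantumFieldTheory.GaussianToolkit.pi_withDensity (fun _ : ↥Λ => (volume : Measure (ChartSU N)).restrict (closedBall 0 S))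
      (fun _ => J₁) (fun _ => hJ₁), ← Measure.restrict_pi_pi, ← closedBall_eq_pi Λ hS, ← volume_pi,
    ← withDensity_indicator measurableSet_closedBall]
  rfl

/-- total mass through (CH): the chart-side section law tilted by a block weight read in the chart has the total mass
of the windowed block section (the finiteness proviso of the engine). [folklore] -/
theorem chartLaw_univ_eq {S : ℝ} (hS : 0 ≤ S) {J₁ : ChartSU N → ℝ≥0∞} (hJ₁ : Measurable J₁)
    (hCH : (HaarData.haar : Measure (SUN N)).restrict (expBallSU S) =
      (((volume : Measure (ChartSU N)).restrict (closedBall 0 S)).withDensity J₁).map expPtSU)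
    {R : (↥Λ → SUN N) → ℝ≥0∞} (hR : Measurable R) :
    ((volume : Measure (BlockChartSU N Λ)).withDensity fun x =>
        chartWeightSU Λ S J₁ x * R (expFibreChartSU Λ u₀ x)) univ =
      ((blockLaw Λ).withDensity fun y => windowSU Λ u₀ S y * R y) univ := by
  rw [T4ShellMeasureDet.withDensity_eq_map_chart (blockLaw Λ) volume (measurable_expFibreChartSU Λ u₀)
      (measurable_chartWeightSU Λ S hJ₁) (measurable_windowSU Λ u₀ S) (chart_suN Λ u₀ hS hJ₁ hCH) hR,
    Measure.map_apply (measurable_expFibreChartSU Λ u₀) MeasurableSet.univ, preimage_univ]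

end ChartIdentity

/-! ## §4 The realized engine for `G = SU(N)`: (M1) from (CH)₁, a centre-monotone `J₁`, the core map and the
ray-weight loss -/

section Realized

variable [NeZero N]


variable {P : Params} {j : ℕ} [DecidableEq (PBond P j)]

open T4ShellMeasureDet (blockLaw slotAntiConcentration_of_chart slotAntiConcentration_realized_of_sections
  measurable_section)

/-- **THE REALIZED ENGINE FOR `G = SU(N)`.**  Data: the bonds `Λ` of the slot's block; a window radius `S ≥ 0`; a
measurable ONE-BOND CHART WEIGHT `J₁` which does not decrease towards the centre on the ball along positive contraction factors (`hJ₁c`, `0 < c ≤ 1`) and for which the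
one-bond chart identity (CH)₁ at the identity holds (`hCH` — DISPLAYED; for `N ≥ 3` NOT in the tree); for every
exterior `V` a chart centre `c V` and a measurable block weight `R V`; the realized density `F` with the WINDOW
FACTORISATION `F(V[Λ := y]) = windowSU Λ (c V) S y · R V y` (`hFw`); per-section finiteness; the tested variable `u`;
numbers `θ, ρ ≥ 0`, a depth `a ≥ 0`, `B_f`, and `D` with `(#Λ·d_N + B_f)·a ≤ D·ρ`.  ANALYTIC HYPOTHESES, per `V`, for
chart points `x` in the window, on the support of `R V` and below the threshold ONLY: (S-i) `hcore` — the contraction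
`e^{−a}x` is read below `θ(1−ρ)`; (S-ii) `hden` — `R V(κ x) ≤ e^{B_f a}·R V(κ(e^{−a}x))`, the block weight ALONE
(`J₁` and the window ride free by §2, the chart identity is `chart_suN`).  CONCLUSION: (M1)
`SlotAntiConcentration ((fieldMeasure P j SU(N)).withDensity F) u θ ρ D`.  For `N = 2` compare
`ShellMeasureScalingSU2.slotAntiConcentration_realized_su2_of_coreMap` (cube window, (CH) PROVED). [folklore] -/
theorem slotAntiConcentration_realized_suN_of_coreMap (Λ : Finset (PBond P j)) {S : ℝ} (hS : 0 ≤ S)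
    {J₁ : ChartSU N → ℝ≥0∞} (hJ₁ : Measurable J₁)
    (hJ₁c : ∀ v : ChartSU N, ‖v‖ ≤ S → ∀ c : ℝ, 0 < c → c ≤ 1 → J₁ v ≤ J₁ (c • v))
    (hCH : (HaarData.haar : Measure (SUN N)).restrict (expBallSU S) =
      (((volume : Measure (ChartSU N)).restrict (closedBall 0 S)).withDensity J₁).map expPtSU)
    (c : GaugeField P j (SUN N) → GaugeField P j (SUN N))
    {R : GaugeField P j (SUN N) → (↥Λ → SUN N) → ℝ≥0∞} (hR : ∀ V, Measurable (R V))
    {F : GaugeField P j (SUN N) → ℝ≥0∞} (hF : Measurable F)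
    (hFw : ∀ V y, F (updateFinset V Λ y) = windowSU Λ (c V) S y * R V y)
    (hfin : ∀ V, ((blockLaw Λ).withDensity fun y => F (updateFinset V Λ y)) univ ≠ ∞)
    {u : GaugeField P j (SUN N) → ℝ} (hu : Measurable u) {θ ρ a Bf D : ℝ} (hθ : 0 ≤ θ) (hρ : 0 ≤ ρ) (ha : 0 ≤ a)
    (haD : ((Λ.card * dimSU N : ℕ) + Bf) * a ≤ D * ρ)
    (hcore : ∀ V x, x ∈ closedBall (0 : BlockChartSU N Λ) S → R V (expFibreChartSU Λ (c V) x) ≠ 0 →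
      u (updateFinset V Λ (expFibreChartSU Λ (c V) x)) < θ →
      u (updateFinset V Λ (expFibreChartSU Λ (c V) (Real.exp (-a) • x))) < θ * (1 - ρ))
    (hden : ∀ V x, x ∈ closedBall (0 : BlockChartSU N Λ) S → R V (expFibreChartSU Λ (c V) x) ≠ 0 →
      u (updateFinset V Λ (expFibreChartSU Λ (c V) x)) < θ →
      R V (expFibreChartSU Λ (c V) x) ≤
        ENNReal.ofReal (Real.exp (Bf * a)) * R V (expFibreChartSU Λ (c V) (Real.exp (-a) • x))) :
    SlotAntiConcentration ((fieldMeasure P j (SUN N)).withDensity F) u θ ρ D := by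
  refine slotAntiConcentration_realized_of_sections Λ hF hu fun V => ?_
  have hκ : Measurable (expFibreChartSU Λ (c V)) := measurable_expFibreChartSU Λ (c V)
  have hsecF : (fun y => F (updateFinset V Λ y)) = fun y => windowSU Λ (c V) S y * R V y := funext (hFw V)
  have huV : Measurable fun y => u (updateFinset V Λ y) := measurable_section Λ hu V
  rw [hsecF]
  refine slotAntiConcentration_of_chart (blockLaw Λ) volume hκ (measurable_chartWeightSU Λ S hJ₁)
    (measurable_windowSU Λ (c V) S) (chart_suN Λ (c V) hS hJ₁ hCH) (hR V) huV ?_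
  -- (M1) in the chart: the engine in H-form with the chart weight riding free
  have hfin' : ((volume : Measure (BlockChartSU N Λ)).withDensity fun x =>
      chartWeightSU Λ S J₁ x * R V (expFibreChartSU Λ (c V) x))
        {x | ((fun y => u (updateFinset V Λ y)) ∘ expFibreChartSU Λ (c V)) x < θ} ≠ ∞ := by
    refine ne_top_of_le_ne_top ?_ (measure_mono (subset_univ _))
    rw [chartLaw_univ_eq Λ (c V) hS hJ₁ hCH (hR V), ← hsecF]
    exact hfin V
  refine slotAntiConcentration_of_coreMap_mul volume (huV.comp hκ) (Bf := Bf) (D := D) hθ hρ hfin'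
    (fun x => chartWeightSU_le_smul_of_pos Λ hJ₁c ha x) (fun x hx hJ hg => ?_) (fun x hx hJ hg => ?_) ?_
  · exact hcore V x (mem_closedBall_of_chartWeightSU_ne_zero Λ hJ) hg hx
  · exact hden V x (mem_closedBall_of_chartWeightSU_ne_zero Λ hJ) hg hx
  · rw [finrank_blockChart]
    exact haD

end Realized

end Summit.QuantumFields.BalabanUV.T4Continuum.ShellMeasureScalingSUN

end
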